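import Summits.NavierStokesRegularity.NavierStokesRegularity.Theorems.HubbleDynamoDilutionBudget
import Summits.NavierStokesRegularity.NavierStokesRegularity.Theorems.HubbleDynamoSteadyInductionIdentity
import Literature.Analysis.FluidPDE.LocalBiotSavartCalculus
import Literature.Analysis.FluidPDE.PoincareHomotopyOperatorL2
import HarnessLib

/-!
# The helicity-flux identity of a Leray profile, I: pointwise balance and truncation
# (route `HubbleDynamo`, item `HelicityFluxIdentity`, stmt-NavierStokesRegularity-2060)

Helper file (all results proved; no definitions, no named facts). The item is the steady /
periodic magnetic-helicity balance of the route's dictionary (card self-dynamo-hubble-flow (v)):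
in Leray's similarity variables the vorticity `Ω = curl U` of a profile flow is a "magnetic field"
maintained by the wind `V = U + a y` (`νΔΩ + curl (V × Ω) = 0`, `SteadyInductionIdentity`), its
vector potential in the Coulomb gauge is `A = U` itself, and the magnetic helicity `∫ A·B` is the
PROFILE HELICITY `∫ ⟪U, Ω⟫`. This file proves, for a steady Leray profile
`−νΔU + aU + a(y·∇)U + (U·∇)U + ∇P = 0`, `div U = 0` on `ℝ³` (`IsLerayProfile ν a U P`):

* `hubbleHelicity_divergence_flux` — the **pointwise helicity balance in divergence form**
  `div F = 2ν ⟪Ω, curl Ω⟫`, with the helicity flux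
  `F = (½|U|² − P) Ω − ⟪U, Ω⟫ (U + a y) − ν (curl Ω) × U`.
  Mechanism: `E := V × Ω − ν curl Ω` is a gradient, `E = ∇Π` with Tsai's head pressure
  `Π = P + ½|U|² + a ⟪y, U⟫` (Lamb form, `y × curl U = ∇⟪y,U⟫ − (y·∇)U − U`, `curl curl = −Δ` on
  solenoidal fields); hence `div (Π Ω) = ⟪E, Ω⟫ = −ν⟪Ω, curl Ω⟫` and
  `div (E × U) = −⟪E, curl U⟫ = ν⟪Ω, curl Ω⟫`, and `F = E × U − Π Ω` because
  `⟪U, V⟫ − Π = ½|U|² − P`. NOTE the cancellation: the two flux terms `⟪U,V⟫ Ω` and `Π Ω`, each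
  `O(1)` through spheres `|y| = R` in the Type-I decay class (`a⟪y,U⟫ = O(1)`), cancel
  IDENTICALLY; what is left of them, `(½|U|² − P) Ω`, is `O(R⁻³)`. (The proof given is the
  equivalent direct expansion: Leibniz rules for `div`, the vorticity equation
  `hubbleDilution_vorticity_eq` paired with `U`, the profile equation paired with `Ω`.)
* `hubbleHelicity_truncated` — the **truncated balance**: for a compactly supported `C¹` cut-off
  `φ`, `a ∫ (y·∇φ) ⟪U,Ω⟫ = 2ν ∫ φ ⟪Ω, curl Ω⟫ + ∫ ∇φ·((½|U|²−P)Ω) − ∫ ∇φ·(⟪U,Ω⟫ U)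
  − ν ∫ ∇φ·((curl Ω) × U)` (whole-space integration by parts, tree file `WholeSpaceIBP`).

The limit `R → ∞` along the cut-off family `cutoff R` in the Type-I decay class — the identity
proper, with the boundary term at infinity shown to converge — is part II,
`HubbleDynamoHelicityFluxIdentity`.

References: H. K. Moffatt, J. Fluid Mech. 35 (1969) 117–129, §§2–3 (helicity and magnetic
helicity as transport invariants); L. Woltjer, Proc. Natl. Acad. Sci. USA 44 (1958) 489–491
(`∫ A·B`); U. Frisch, *Turbulence* (CUP 1995), (2.24)–(2.29) (`dH/dt = −2ν ∫ ω·curl ω`);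
T.-P. Tsai, Arch. Rational Mech. Anal. 143 (1998) 29–51, §5 (head pressure `Π` of a Leray
profile); Majda–Bertozzi, *Vorticity and Incompressible Flow* (CUP 2002), §1.1, §1.7.
-/

noncomputable section

-- D-0017: `<Problem> = <Summit>` by design; the lakefile turns this linter off for `Summits`.
set_option linter.dupNamespace false

open MeasureTheory Set Function Filter Topology InnerProductSpace
open scoped RealInnerProductSpace Laplacian ContDiff

namespace Summit.NavierStokesRegularity.NavierStokesRegularity.Theorems

open Literature.Analysis.FluidPDE

/-! ### Pointwise calculus -/

/-- `⟪u, ∇θ(x)⟫ = Dθ(x) u`: the gradient paired on the right is the derivative. -/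
theorem hubbleHelicity_inner_gradient_right {θ : EuclideanSpace ℝ (Fin 3) → ℝ}
    (x u : EuclideanSpace ℝ (Fin 3)) : ⟪u, gradient θ x⟫ = fderiv ℝ θ x u := by
  rw [real_inner_comm, gradient, InnerProductSpace.toDual_symm_apply]

/-- `⟪∇θ(x), u⟫ = Dθ(x) u`. -/
theorem hubbleHelicity_inner_gradient_left {θ : EuclideanSpace ℝ (Fin 3) → ℝ}
    (x u : EuclideanSpace ℝ (Fin 3)) : ⟪gradient θ x, u⟫ = fderiv ℝ θ x u := by
  rw [gradient, InnerProductSpace.toDual_symm_apply]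

/-- `D(‖U‖²/2)(y) w = ⟪U y, DU(y) w⟫` for a field differentiable at `y`. -/
theorem hubbleHelicity_fderiv_half_norm_sq {U : EuclideanSpace ℝ (Fin 3) → EuclideanSpace ℝ (Fin 3)}
    {y : EuclideanSpace ℝ (Fin 3)} (hU : DifferentiableAt ℝ U y) (w : EuclideanSpace ℝ (Fin 3)) :
    fderiv ℝ (fun z => ‖U z‖ ^ 2 / 2) y w = ⟪U y, fderiv ℝ U y w⟫ := by
  have e : (fun z => ‖U z‖ ^ 2 / 2) = fun z => (2⁻¹ : ℝ) * ⟪U z, U z⟫ := by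
    funext z
    rw [real_inner_self_eq_norm_sq]
    ring
  rw [e, fderiv_const_mul (hU.inner ℝ hU) (2⁻¹ : ℝ), _root_.smul_apply, fderiv_inner_apply ℝ hU hU,
    real_inner_comm (U y) (fderiv ℝ U y w), smul_eq_mul]
  ring

/-! ### The pointwise helicity balance of a steady Leray profile -/

/-- **Helicity balance of a Leray profile, divergence form.** For a Leray profile
`−νΔU + aU + a(y·∇)U + (U·∇)U + ∇P = 0`, `div U = 0` on `ℝ³` with `U ∈ C⁴`, `P ∈ C²`, the
vorticity `Ω = curl U`, the wind `V = U + a y` and the helicity density `h = ⟪U, Ω⟫` satisfy the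
pointwise identity

  `div F = 2ν ⟪Ω, curl Ω⟫`,  `F := (½|U|² − P) Ω − h V − ν (curl Ω) × U`

(the steady magnetic-helicity balance of the induction equation `νΔΩ + curl (V × Ω) = 0` in the
Coulomb gauge `A = U`: with `E := V × Ω − ν curl Ω = ∇Π`, `Π = P + ½|U|² + a⟪y, U⟫`, one has
`div (Π Ω) = −ν⟪Ω, curl Ω⟫` and `div (E × U) = ν⟪Ω, curl Ω⟫`, and
`E × U − Π Ω = (½|U|² − P) Ω − h V − ν (curl Ω) × U` because `⟪U, V⟫ − Π = ½|U|² − P`: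
the two `O(1)`-at-infinity terms `⟪U,V⟫Ω` and `ΠΩ` cancel identically). -/
theorem hubbleHelicity_divergence_flux {ν a : ℝ}
    {U : EuclideanSpace ℝ (Fin 3) → EuclideanSpace ℝ (Fin 3)} {P : EuclideanSpace ℝ (Fin 3) → ℝ}
    (hU : ContDiff ℝ 4 U) (hP : ContDiff ℝ 2 P) (h : IsLerayProfile ν a U P)
    (y : EuclideanSpace ℝ (Fin 3)) :
    VectorCalculus.divergence (fun z =>
        ((‖U z‖ ^ 2 / 2 - P z) • curl U z - ⟪U z, curl U z⟫ • (U z + a • z))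
          - ν • cross (curl (curl U) z) (U z)) y
      = 2 * ν * ⟪curl U y, curl (curl U) y⟫ := by
  -- regularity
  have hU3 : ContDiff ℝ 3 U := hU.of_le (by norm_num)
  have hU2 : ContDiff ℝ 2 U := hU.of_le (by norm_num)
  have hU1 : ContDiff ℝ 1 U := hU.of_le (by norm_num)
  have hP1 : ContDiff ℝ 1 P := hP.of_le (by norm_num)
  have hΩ2 : ContDiff ℝ 2 (curl U) := contDiff_curl (n := 2) (by exact_mod_cast hU3)
  have hΩ1 : ContDiff ℝ 1 (curl U) := contDiff_curl (n := 1) (by exact_mod_cast hU2)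
  have hΞ1 : ContDiff ℝ 1 (curl (curl U)) := contDiff_curl (n := 1) (by exact_mod_cast hΩ2)
  have hΩdiv : VectorCalculus.IsDivFree (curl U) := fun x => divergence_curl_eq_zero_holds U hU2 x
  have dU : DifferentiableAt ℝ U y := (hU1.differentiable one_ne_zero) y
  have dP : DifferentiableAt ℝ P y := (hP1.differentiable one_ne_zero) y
  have dΩ : DifferentiableAt ℝ (curl U) y := (hΩ1.differentiable one_ne_zero) y
  have dΞ : DifferentiableAt ℝ (curl (curl U)) y := (hΞ1.differentiable one_ne_zero) y
  have dlin : DifferentiableAt ℝ (fun z : EuclideanSpace ℝ (Fin 3) => a • z) y :=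
    (hubbleDynamo_hasFDerivAt_const_smul_id a y).differentiableAt
  have dV : DifferentiableAt ℝ (fun z => U z + a • z) y := dU.add dlin
  have dh : DifferentiableAt ℝ (fun z => ⟪U z, curl U z⟫) y := dU.inner ℝ dΩ
  have dn : DifferentiableAt ℝ (fun z => ‖U z‖ ^ 2 / 2) y := by
    have e : (fun z => ‖U z‖ ^ 2 / 2) = fun z => (2⁻¹ : ℝ) * ⟪U z, U z⟫ := by
      funext z
      rw [real_inner_self_eq_norm_sq]
      ring
    rw [e]
    exact (dU.inner ℝ dU).const_mul _
  have dq : DifferentiableAt ℝ (fun z => ‖U z‖ ^ 2 / 2 - P z) y := dn.sub dP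
  have dT1 : DifferentiableAt ℝ (fun z => ⟪U z, curl U z⟫ • (U z + a • z)) y := dh.smul dV
  have dT2 : DifferentiableAt ℝ (fun z => (‖U z‖ ^ 2 / 2 - P z) • curl U z) y := dq.smul dΩ
  have dT3 : DifferentiableAt ℝ (fun z => cross (curl (curl U) z) (U z)) y :=
    (hasFDerivAt_cross dΞ.hasFDerivAt dU.hasFDerivAt).differentiableAt
  have dT21 : DifferentiableAt ℝ
      (fun z => (‖U z‖ ^ 2 / 2 - P z) • curl U z - ⟪U z, curl U z⟫ • (U z + a • z)) y :=
    dT2.sub dT1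
  have dT3ν : DifferentiableAt ℝ (fun z => ν • cross (curl (curl U) z) (U z)) y := dT3.const_smul ν
  -- split the divergence
  rw [divergence_sub_apply dT21 dT3ν, divergence_sub_apply dT2 dT1,
    divergence_const_smul_apply dT3, divergence_smul_apply dq dΩ, divergence_smul_apply dh dV,
    divergence_cross_holds _ _ y dΞ dU, divergence_add_apply dU dlin,
    hubbleDynamo_divergence_const_smul_id, hΩdiv y, h.divFree y,
    curl_curl_eq_neg_laplacian hΩ2 hΩdiv y,
    hubbleHelicity_inner_gradient_right, hubbleHelicity_inner_gradient_right,
    fderiv_fun_sub dn dP, fderiv_inner_apply ℝ dU dΩ]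
  simp only [_root_.sub_apply, hubbleHelicity_fderiv_half_norm_sq dU, map_add, map_smul,
    inner_add_right, inner_smul_right, inner_neg_right, inner_add_left, inner_smul_left, mul_zero,
    zero_add]
  -- the vorticity equation, paired with `U`
  have eV := congrArg (fun v => ⟪U y, v⟫) (hubbleDilution_vorticity_eq hU hP h y)
  -- the profile equation, paired with `Ω`
  have eP := congrArg (fun v => ⟪v, curl U y⟫) (h.profile_eq y)
  simp only [inner_add_right, inner_sub_right, inner_smul_right, inner_add_left, inner_smul_left,
    inner_neg_left, inner_zero_left, convect_apply, laplacian_eq_neg_curl_curl hU2 h.divFree y,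
    inner_neg_left, hubbleHelicity_inner_gradient_left, RCLike.conj_to_real] at eV eP
  have ec : ⟪curl (curl U) y, curl U y⟫ = ⟪curl U y, curl (curl U) y⟫ := real_inner_comm _ _
  rw [ec] at eP ⊢
  linear_combination eV - eP


/-! ### Norm and smoothness bookkeeping -/

/-- The cross product of two `Cⁿ` fields is `Cⁿ`. -/
theorem hubbleHelicity_contDiff_cross {n : ℕ∞}
    {f g : EuclideanSpace ℝ (Fin 3) → EuclideanSpace ℝ (Fin 3)} (hf : ContDiff ℝ n f)
    (hg : ContDiff ℝ n g) : ContDiff ℝ n (fun z => cross (f z) (g z)) :=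
  (crossCLM.contDiff.comp hf).clm_apply hg

/-- The helicity flux `F = (½|U|² − P) Ω − h V − ν (curl Ω) × U` of a `C³` velocity and a `C¹`
pressure is `C¹`. -/
theorem hubbleHelicity_contDiff_flux {ν a : ℝ}
    {U : EuclideanSpace ℝ (Fin 3) → EuclideanSpace ℝ (Fin 3)} {P : EuclideanSpace ℝ (Fin 3) → ℝ}
    (hU : ContDiff ℝ 3 U) (hP : ContDiff ℝ 1 P) :
    ContDiff ℝ 1 (fun z =>
        ((‖U z‖ ^ 2 / 2 - P z) • curl U z - ⟪U z, curl U z⟫ • (U z + a • z))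
          - ν • cross (curl (curl U) z) (U z)) := by
  have hU2 : ContDiff ℝ 2 U := hU.of_le (by norm_num)
  have hU1 : ContDiff ℝ 1 U := hU.of_le (by norm_num)
  have hΩ2 : ContDiff ℝ 2 (curl U) := contDiff_curl (n := 2) (by exact_mod_cast hU)
  have hΩ1 : ContDiff ℝ 1 (curl U) := contDiff_curl (n := 1) (by exact_mod_cast hU2)
  have hΞ1 : ContDiff ℝ 1 (curl (curl U)) := contDiff_curl (n := 1) (by exact_mod_cast hΩ2)
  have hn : ContDiff ℝ 1 (fun z => ‖U z‖ ^ 2 / 2) := ((contDiff_norm_sq ℝ).comp hU1).div_const 2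
  have hq : ContDiff ℝ 1 (fun z => ‖U z‖ ^ 2 / 2 - P z) := hn.sub hP
  have hh : ContDiff ℝ 1 (fun z => ⟪U z, curl U z⟫) := hU1.inner ℝ hΩ1
  have hV : ContDiff ℝ 1 (fun z : EuclideanSpace ℝ (Fin 3) => U z + a • z) :=
    hU1.add (contDiff_id.const_smul a)
  exact ((hq.smul hΩ1).sub (hh.smul hV)).sub ((hubbleHelicity_contDiff_cross hΞ1 hU1).const_smul ν)

/-- A continuous integrand cut off by the derivative of a compactly supported `C¹` function is
integrable: `y ↦ Dφ(y)(G y) ∈ L¹`. -/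
theorem hubbleHelicity_integrable_fderiv_apply {φ : EuclideanSpace ℝ (Fin 3) → ℝ}
    (hφ : ContDiff ℝ 1 φ) (hφs : HasCompactSupport φ)
    {G : EuclideanSpace ℝ (Fin 3) → EuclideanSpace ℝ (Fin 3)} (hG : Continuous G) :
    Integrable (fun y => fderiv ℝ φ y (G y)) := by
  refine ((hφ.continuous_fderiv one_ne_zero).clm_apply hG).integrable_of_hasCompactSupport ?_
  refine (hφs.fderiv (𝕜 := ℝ)).mono fun y hy => ?_
  contrapose! hy
  simp only [mem_support, not_not] at hy ⊢
  simp [hy]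

/-! ### The truncated helicity balance -/

/-- **Truncated helicity balance.** For a Leray profile with `U ∈ C⁴`, `P ∈ C²` and a compactly
supported `C¹` cut-off `φ`, testing `div F = 2ν⟪Ω, curl Ω⟫` (`hubbleHelicity_divergence_flux`)
against `φ` and integrating by parts on the whole space (no boundary terms) gives

  `a ∫ (y·∇φ) h = 2ν ∫ φ ⟪Ω, curl Ω⟫ + ∫ ∇φ·((½|U|² − P) Ω) − ∫ ∇φ·(h U) − ν ∫ ∇φ·((curl Ω) × U)`,

`h = ⟪U, Ω⟫`: the Hubble transport of helicity through the cut-off layer (left) equals the Ohmic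
destruction of helicity inside (first term on the right) up to three flux terms that are small at
infinity in the Type-I decay class. -/
theorem hubbleHelicity_truncated {ν a : ℝ}
    {U : EuclideanSpace ℝ (Fin 3) → EuclideanSpace ℝ (Fin 3)} {P : EuclideanSpace ℝ (Fin 3) → ℝ}
    (hU : ContDiff ℝ 4 U) (hP : ContDiff ℝ 2 P) (h : IsLerayProfile ν a U P)
    {φ : EuclideanSpace ℝ (Fin 3) → ℝ} (hφ : ContDiff ℝ 1 φ) (hφs : HasCompactSupport φ) :
    a * ∫ y, fderiv ℝ φ y y * ⟪U y, curl U y⟫ =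
      2 * ν * (∫ y, φ y * ⟪curl U y, curl (curl U) y⟫)
        + (∫ y, fderiv ℝ φ y ((‖U y‖ ^ 2 / 2 - P y) • curl U y))
        - (∫ y, fderiv ℝ φ y (⟪U y, curl U y⟫ • U y))
        - ν * ∫ y, fderiv ℝ φ y (cross (curl (curl U) y) (U y)) := by
  have hU3 : ContDiff ℝ 3 U := hU.of_le (by norm_num)
  have hU2 : ContDiff ℝ 2 U := hU.of_le (by norm_num)
  have hU1 : ContDiff ℝ 1 U := hU.of_le (by norm_num)
  have hP1 : ContDiff ℝ 1 P := hP.of_le (by norm_num)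
  have hΩ2 : ContDiff ℝ 2 (curl U) := contDiff_curl (n := 2) (by exact_mod_cast hU3)
  have hΩ1 : ContDiff ℝ 1 (curl U) := contDiff_curl (n := 1) (by exact_mod_cast hU2)
  have hΞ1 : ContDiff ℝ 1 (curl (curl U)) := contDiff_curl (n := 1) (by exact_mod_cast hΩ2)
  have cU : Continuous U := hU1.continuous
  have cP : Continuous P := hP1.continuous
  have cΩ : Continuous (curl U) := hΩ1.continuous
  have cΞ : Continuous (curl (curl U)) := hΞ1.continuous
  have ch : Continuous (fun z => ⟪U z, curl U z⟫) := cU.inner cΩ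
  have cq : Continuous (fun z => ‖U z‖ ^ 2 / 2 - P z) := ((cU.norm.pow 2).div_const 2).sub cP
  -- integration by parts against `φ`
  have hF := hubbleHelicity_contDiff_flux (ν := ν) (a := a) hU3 hP1
  have ibp := integral_mul_divergence_add_eq_zero_left hφ hF hφs
  -- the four flux integrands
  have i1 : Integrable (fun y => fderiv ℝ φ y ((‖U y‖ ^ 2 / 2 - P y) • curl U y)) :=
    hubbleHelicity_integrable_fderiv_apply hφ hφs (cq.smul cΩ)
  have i2 : Integrable (fun y => fderiv ℝ φ y (⟪U y, curl U y⟫ • U y)) :=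
    hubbleHelicity_integrable_fderiv_apply hφ hφs (ch.smul cU)
  have i3 : Integrable (fun y => fderiv ℝ φ y y * ⟪U y, curl U y⟫) := by
    have := hubbleHelicity_integrable_fderiv_apply hφ hφs
      (G := fun y => ⟪U y, curl U y⟫ • y) (ch.smul continuous_id)
    refine this.congr (Eventually.of_forall fun y => ?_)
    simp only [map_smul, smul_eq_mul]
    ring
  have i4 : Integrable (fun y => fderiv ℝ φ y (cross (curl (curl U) y) (U y))) :=
    hubbleHelicity_integrable_fderiv_apply hφ hφs
      ((hubbleHelicity_contDiff_cross hΞ1 hU1).continuous)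
  -- rewrite both integrals of the integration-by-parts identity
  have e1 : ∫ y, φ y * VectorCalculus.divergence (fun z =>
        ((‖U z‖ ^ 2 / 2 - P z) • curl U z - ⟪U z, curl U z⟫ • (U z + a • z))
          - ν • cross (curl (curl U) z) (U z)) y
      = 2 * ν * ∫ y, φ y * ⟪curl U y, curl (curl U) y⟫ := by
    rw [← integral_const_mul]
    refine integral_congr_ae (Eventually.of_forall fun y => ?_)
    simp only [hubbleHelicity_divergence_flux hU hP h y]
    ring
  have e2 : ∫ y, ⟪((‖U y‖ ^ 2 / 2 - P y) • curl U y - ⟪U y, curl U y⟫ • (U y + a • y))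
          - ν • cross (curl (curl U) y) (U y), gradient φ y⟫
      = ∫ y, (((fderiv ℝ φ y ((‖U y‖ ^ 2 / 2 - P y) • curl U y)
          - fderiv ℝ φ y (⟪U y, curl U y⟫ • U y))
          - a * (fderiv ℝ φ y y * ⟪U y, curl U y⟫))
          - ν * fderiv ℝ φ y (cross (curl (curl U) y) (U y))) := by
    refine integral_congr_ae (Eventually.of_forall fun y => ?_)
    simp only [hubbleHelicity_inner_gradient_right, map_sub, map_add, map_smul, smul_eq_mul]
    ring
  rw [integral_sub ((i1.sub' i2).sub' (i3.const_mul a)) (i4.const_mul ν),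
    integral_sub (i1.sub' i2) (i3.const_mul a), integral_sub i1 i2, integral_const_mul,
    integral_const_mul] at e2
  rw [e1, e2] at ibp
  linear_combination -ibp



end Summit.NavierStokesRegularity.NavierStokesRegularity.Theorems

end
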